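import Summits.ResolutionOfSingularities.ResolutionOfSingularities.Theorems.HilbertSamuelEliminationSigmaMaxModificationsCorridor3StratumRound
import Literature.AlgebraicGeometry.Resolution.BlowupStalkCharts
import Literature.AlgebraicGeometry.Resolution.AffineBlowupUniversal
import HarnessLib

/-!
# Route `HilbertSamuelElimination`, crux `SigmaMaxModificationsCorridor3`
# (stmt-ResolutionOfSingularities-19249; child of `SigmaMaxModifications` stmt-…-18506),
# line `tame_wild` v3 — THE FIBRE OF A ROUND OVER A CODIMENSION-ONE POINT IS A QUADRATIC TRANSFORM

[OURS · L1 W4.2] Brick W1 of the FC-R1 assembly plan (HOME `L/res-L1-w42-stub-3/FCR1-PLAN.md`):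
after a confinement round (`exists_centreSeq_round`, p482115) the last centre `D` satisfies
`D_{y₁} = 𝔪_{y₁}` at the unique point `y₁` over a maximal point of the resolved surface. This file
identifies the points of the blow-up `Bl_D Y_r` over such a point with the points of the blow-up
of the LOCAL scheme `Spec 𝒪_{Y_r,y₁}` along its closed point — the first quadratic transform of the
one-dimensional local ring — with isomorphic local rings (blow-ups commute with the flat base change
`Spec 𝒪_{X,x} → X`, Görtz–Wedhorn Prop. 13.91 (2); uniqueness of blow-ups; the projection
`X' ×_X Spec 𝒪_{X,x} → X'` is a pro-open immersion), so that the termination of the rounds over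
the codimension-one points becomes the classical finiteness of the quadratic sequence of a
one-dimensional local ring with reduced completion (Krull 1930; Kollár 2007, Thm. 1.101).

* `exists_point_affineBlowup_of_stalkIdeal_eq_maximalIdeal` — for a blow-up `π : X' → X` along
  `D` and a point `x` with `D_x = 𝔪_x`, every `x'` over `x` comes from a point `p` of
  `Bl_{𝔪_x}(Spec 𝒪_{X,x})` over the closed point with `𝒪_{Bl,p} ≅ 𝒪_{X',x'}`.
* `ringKrullDim_stalk_le_one_of_over` — and `dim 𝒪_{X',x'} ≤ dim 𝒪_{X,x}` (tree), so over a
  codimension-one point the new points are again of dimension `≤ 1`.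

NOT a statement of any manuscript; AI-written, weaker than expert review.

## Sources

* U. Görtz, T. Wedhorn, *Algebraic Geometry I* (2020), Prop. 13.91 (2), Def. 13.90.
  [GortzWedhorn2020]
* J. Kollár, *Lectures on Resolution of Singularities* (2007), Def. 1.97, Alg. 1.100, Thm. 1.101.
  [Kollar2007]
* The Stacks Project, Tags 01J7, 0804. [StacksProject]
-/

set_option linter.dupNamespace false -- mandated namespace of this single-conjunct summit

noncomputable section

open CategoryTheory CategoryTheory.Limits AlgebraicGeometry TopologicalSpace Topology IsLocalRing
open Literature.AlgebraicGeometry.Resolution Literature.RingTheory.HilbertSamuel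

namespace Summit.ResolutionOfSingularities.ResolutionOfSingularities.Theorems.SigmaMaxModificationsCorridor3.Helpers

universe u

/-- `Spec 𝒪_{X,x} → X` is injective on points (a preimmersion), and only the closed point maps to
`x`. [cite: StacksProject, Tag 01J7] -/
theorem eq_closedPoint_of_fromSpecStalk_eq {X : Scheme.{u}} (x : X)
    (q : Spec (X.presheaf.stalk x)) (hq : (X.fromSpecStalk x).base q = x) :
    q = closedPoint (X.presheaf.stalk x) := by
  apply (X.fromSpecStalk x).isEmbedding.injective
  rw [hq]
  exact (Scheme.fromSpecStalk_closedPoint (x := x)).symm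

/-- **The points of a blow-up over a point `x` with `D_x = 𝔪_x` are points of the first quadratic
transform `Bl_{𝔪_x}(Spec 𝒪_{X,x})`, with the same local rings.** Let `π : X' → X` be a blow-up
along `D` (`IsBlowup π D`) and `x ∈ X` with `D_x = 𝔪_x`. For every `x' ∈ X'` over `x` there is a
point `p` of the blowing up of `Spec 𝒪_{X,x}` along its closed point, lying over the closed point,
with `𝒪_{Bl_{𝔪}(Spec 𝒪_{X,x}), p} ≅ 𝒪_{X',x'}`: base-change `π` along the flat
`Spec 𝒪_{X,x} → X` (a blow-up along `D · 𝒪 = 𝔪~`, Görtz–Wedhorn 13.91 (2)), identify with the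
affine blowing up by uniqueness, and use that `X' ×_X Spec 𝒪_{X,x} → X'` induces isomorphisms of
local rings. [cite: GortzWedhorn2020, Prop. 13.91 (2)] [cite: StacksProject, Tag 0804] -/
theorem exists_point_affineBlowup_of_stalkIdeal_eq_maximalIdeal {X X' : Scheme.{u}}
    {π : X' ⟶ X} {D : X.IdealSheafData} (hπ : IsBlowup π D) {x : X}
    (hD : stalkIdeal D x = maximalIdeal (X.presheaf.stalk x)) {x' : X'} (hx' : π.base x' = x) :
    ∃ p : ↥(affineBlowup (maximalIdeal (X.presheaf.stalk x))),
      (affineBlowup.π (maximalIdeal (X.presheaf.stalk x))).base p =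
          closedPoint (X.presheaf.stalk x) ∧
        Nonempty ((affineBlowup (maximalIdeal (X.presheaf.stalk x))).presheaf.stalk p ≅
          X'.presheaf.stalk x') := by
  haveI : Flat (X.fromSpecStalk x) := flat_fromSpecStalk X x
  -- the base change is a blow-up of `Spec 𝒪_{X,x}` along `𝔪~`
  have hsnd : IsBlowup (pullback.snd π (X.fromSpecStalk x))
      (affineBlowup.idealSheaf (maximalIdeal (X.presheaf.stalk x))) := by
    have h := hπ.pullback_snd_of_flat (X.fromSpecStalk x)
    rwa [comap_fromSpecStalk_eq_affineBlowupIdealSheaf, hD] at h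
  -- hence isomorphic to the affine blowing up, over `Spec 𝒪_{X,x}`
  obtain ⟨e, he, -⟩ := hsnd.unique (affineBlowup.isBlowup (maximalIdeal (X.presheaf.stalk x)))
  -- lift `x'` to the base change
  obtain ⟨s, hs⟩ := mem_range_pullback_fst_fromSpecStalk_of_eq π x hx'
  haveI : IsIso ((pullback.fst π (X.fromSpecStalk x)).stalkMap s) :=
    isIso_stalkMap_pullback_fst_fromSpecStalk π x s
  refine ⟨e.hom.base s, ?_, ⟨?_⟩⟩
  · -- over the closed point
    have h1 : (affineBlowup.π (maximalIdeal (X.presheaf.stalk x))).base (e.hom.base s) =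
        (pullback.snd π (X.fromSpecStalk x)).base s := by
      rw [← Scheme.Hom.comp_apply, he]
    rw [h1]
    apply eq_closedPoint_of_fromSpecStalk_eq
    rw [← Scheme.Hom.comp_apply, ← pullback.condition, Scheme.Hom.comp_apply]
    show π.base ((pullback.fst π (X.fromSpecStalk x)).base s) = x
    rw [hs]; exact hx'
  · -- local rings: `𝒪_{Bl, e s} ≅ 𝒪_{P, s} ≅ 𝒪_{X', x'}`
    have e1 : (affineBlowup (maximalIdeal (X.presheaf.stalk x))).presheaf.stalk (e.hom.base s) ≅
        (pullback π (X.fromSpecStalk x)).presheaf.stalk s := asIso (e.hom.stalkMap s)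
    have e2 : X'.presheaf.stalk ((pullback.fst π (X.fromSpecStalk x)).base s) ≅
        (pullback π (X.fromSpecStalk x)).presheaf.stalk s :=
      asIso ((pullback.fst π (X.fromSpecStalk x)).stalkMap s)
    have e3 : X'.presheaf.stalk ((pullback.fst π (X.fromSpecStalk x)).base s) ≅
        X'.presheaf.stalk x' := eqToIso (by rw [hs])
    exact e1 ≪≫ e2.symm ≪≫ e3

/-- Over a point of codimension one the points of a blow-up have local rings of dimension `≤ 1`
(blowing up does not raise the dimension of the local rings, tree
`IsBlowup.ringKrullDim_stalk_le_of_isLocallyNoetherian`). [cite: GortzWedhorn2020, Prop. 13.91] -/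
theorem ringKrullDim_stalk_le_one_of_over {X X' : Scheme.{u}} [IsLocallyNoetherian X]
    {π : X' ⟶ X} {D : X.IdealSheafData} (hπ : IsBlowup π D) {x : X}
    (hx : ringKrullDim (X.presheaf.stalk x) ≤ 1) {x' : X'} (hx' : π.base x' = x) :
    ringKrullDim (X'.presheaf.stalk x') ≤ 1 := by
  have h := hπ.ringKrullDim_stalk_le_of_isLocallyNoetherian x'
  have hx'' : π.base x' = x := hx'
  rw [show (π.base x' : X) = x from hx''] at h
  exact h.trans hx

end Summit.ResolutionOfSingularities.ResolutionOfSingularities.Theorems.SigmaMaxModificationsCorridor3.Helpers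

end
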